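import Summits.SmoothPoincare4.SmoothPoincare4.Theorems.ConvexBisectionAcyclicBisectionExistsPicardLefschetzVariation
import HarnessLib

/-!
# The crossing number of a page loop: naturality and the passage formula
(wave 3, brick Z6-4 — tools for the evaluation step (γ) of the missing lemma
`crossingNumber_eq_stdSymp` of node N1a `node_M3c_shadow_pageDehnTwist` (Picard–Lefschetz on
shadows) of stub `stub_modelsOnFibred_of_reach` = NF4, line `modp-braid-orbits`, crux
`ConvexBisection.AcyclicBisectionExists`, item stmt-SmoothPoincare4-10508; registered sub-goal
`helper_crossingNumber_passage`)

Two derivative-free tools for COMPUTING crossing numbers `crossingNumber φ K`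
(`…PicardLefschetzPieces.lean`: the winding number of the phase `exp (2πi χ(height φ ·))` along
`K`) of explicit loops with explicit annulus charts:

* §1 **naturality** — `height_comp_of_injective`, `crossingNumber_comp_of_injective`: for an
  injective self-map `h` of the base, `crossingNumber (h ∘ φ) (h ∘ K) = crossingNumber φ K` (the
  transverse coordinate of `h q` in the chart `h ∘ φ` is that of `q` in `φ`); with this, crossing
  numbers of a symmetric configuration of curves (e.g. the orbit of one vanishing cycle under the
  cyclic symmetry `x ↦ e^{2πi/(2g+1)} x` of the pages) are all read in ONE chart;
* §2 **the passage formula** — `crossingNumber_eq_sum_breakpoints`: for breakpoints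
  `0 = b₀ ≤ b₁ ≤ ⋯ ≤ b_N = 1` cutting the unit-period loop into pieces each inside the open annulus
  `φ(ℝ × (−1, 1))` or off the closed collar `φ(ℝ × [−1/2, 1/2])`,
  `crossingNumber φ K = Σ_{outside pieces} (outerInd qᵢ − outerInd qᵢ₊₁)`, `qᵢ = K (e^{2πibᵢ})`
  (V7's `crossingNumber_eq_sum` is the case of equal pieces); `crossingNumber_eq_sum_inside` —
  equivalently `Σ_{inside pieces} (outerInd qᵢ₊₁ − outerInd qᵢ)` (telescoping), each term the net
  passage `[hᵢ₊₁ ≥ 1/2] − [hᵢ ≥ 1/2] ∈ {−1, 0, 1}` of the piece across the collar when its ends are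
  off the collar (`outerInd_eq_of_piece`: constant along a piece inside the annulus and off the
  collar);
  **`crossingNumber_single_passage`** (`helper_crossingNumber_passage`) — a loop crossing the
  annulus once, upwards (from height `< −1/2` to height `> 1/2` inside the annulus, off the collar
  elsewhere), has crossing number `1`.

Everything is proved; no definitions, no named facts, no `sorry`.  References: B. Farb,
D. Margalit, *A primer on mapping class groups* (2012), §6.1 [FarbMargalit2012]; W. Fulton,
*Algebraic Topology: A First Course* (1995), §3 (winding numbers by counting) [Fulton1995].
-/

noncomputable section

set_option linter.dupNamespace false

open scoped Manifold ContDiff Topology Real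
open Set Function Metric Filter
open Literature.Topology.FourManifolds Literature.Topology.FourManifolds.LefschetzBase

namespace Summit.SmoothPoincare4.SmoothPoincare4.Theorems.AcyclicBisectionExists.ModpBraidOrbits

variable {g : ℕ} {c : ℂ} {φ : ℝ × ℝ → Base g} {K : sphere (0 : EuclideanSpace ℝ (Fin 2)) 1 → Base g}

/-! ## §1 Naturality under injective self-maps of the base -/

/-- **The transverse coordinate is natural**: for an injective `h`, the height of `h q` in the
chart `h ∘ φ` is the height of `q` in `φ`. [folklore] -/
theorem height_comp_of_injective {h : Base g → Base g} (hinj : Injective h)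
    (hφ1 : ∀ u r, φ (u + 1, r) = φ (u, r)) (hφi : InjOn φ (Ico (0 : ℝ) 1 ×ˢ Ioo (-1 : ℝ) 1))
    (q : Base g) : height (h ∘ φ) (h q) = height φ q := by
  have h1 : ∀ u r, (h ∘ φ) (u + 1, r) = (h ∘ φ) (u, r) := fun u r => by
    simp only [Function.comp_apply, hφ1]
  have hi : InjOn (h ∘ φ) (Ico (0 : ℝ) 1 ×ˢ Ioo (-1 : ℝ) 1) := hinj.comp_injOn hφi
  by_cases hA : q ∈ φ '' (univ ×ˢ Ioo (-1 : ℝ) 1)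
  · obtain ⟨p, ⟨-, hp⟩, rfl⟩ := hA
    rw [height_of_lift hφ1 hφi (u₀ := p.1) (r₀ := p.2) hp]
    exact height_of_lift h1 hi (u₀ := p.1) (r₀ := p.2) hp
  · rw [height_of_not_mem hA, height_of_not_mem]
    rintro ⟨p, hp, hpq⟩
    exact hA ⟨p, hp, hinj hpq⟩

/-- **The crossing number is natural**: `crossingNumber (h ∘ φ) (h ∘ K) = crossingNumber φ K` for
an injective self-map `h` of the base. [cite: FarbMargalit2012, §6.1] -/
theorem crossingNumber_comp_of_injective {h : Base g → Base g} (hinj : Injective h)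
    (hφ1 : ∀ u r, φ (u + 1, r) = φ (u, r)) (hφi : InjOn φ (Ico (0 : ℝ) 1 ×ˢ Ioo (-1 : ℝ) 1)) :
    crossingNumber (h ∘ φ) (h ∘ K) = crossingNumber φ K := by
  unfold crossingNumber
  congr 1
  funext t
  simp only [phaseLoop, Function.comp_apply]
  rw [height_comp_of_injective hinj hφ1 hφi]

/-! ## §2 The passage formula -/

/-- Monotone breakpoints stay between the end ones. [folklore] -/
theorem breakpoints_mem_Icc {b : ℕ → ℝ} {N : ℕ} (hb0 : b 0 = 0) (hbN : b N = 1)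
    (hmono : ∀ i < N, b i ≤ b (i + 1)) {i : ℕ} (hi : i ≤ N) : b i ∈ Icc (0 : ℝ) 1 := by
  have key : ∀ j k : ℕ, j + k ≤ N → b j ≤ b (j + k) := by
    intro j k
    induction k with
    | zero => intro; simp
    | succ k ih =>
      intro hk
      exact (ih (by omega)).trans (by rw [← add_assoc]; exact hmono _ (by omega))
  constructor
  · have h := key 0 i (by omega)
    rwa [zero_add, hb0] at h
  · have h := key i (N - i) (by omega)
    rwa [Nat.add_sub_cancel' hi, hbN] at h

open Classical in
/-- **The passage formula** (general breakpoints): cut the unit-period loop of the page curve `K`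
at `0 = b₀ ≤ b₁ ≤ ⋯ ≤ b_N = 1` into pieces each inside the open annulus or off the closed collar;
then `crossingNumber φ K = Σᵢ dᵢ` with `dᵢ = 0` for an inside piece and
`dᵢ = outerInd qᵢ − outerInd qᵢ₊₁` (`qᵢ = K (e^{2πibᵢ})`) for an outside piece. [cite: Fulton1995, §3] -/
theorem crossingNumber_eq_sum_breakpoints (hc : ‖c‖ = 1) (hφc : Continuous φ)
    (hφ1 : ∀ u r, φ (u + 1, r) = φ (u, r)) (hφp : ∀ p, φ p ∈ page g c)
    (hφi : InjOn φ (Ico (0 : ℝ) 1 ×ˢ Ioo (-1 : ℝ) 1)) (hK : Continuous K)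
    (hKc : ∀ θ, K θ ∈ page g c) {N : ℕ} (b : ℕ → ℝ) (hb0 : b 0 = 0) (hbN : b N = 1)
    (hmono : ∀ i < N, b i ≤ b (i + 1))
    (hdes : ∀ i < N,
      (∀ t ∈ Icc (b i) (b (i + 1)), K (circlePt t) ∈ φ '' (univ ×ˢ Ioo (-1 : ℝ) 1)) ∨
      (∀ t ∈ Icc (b i) (b (i + 1)), K (circlePt t) ∉ φ '' (univ ×ˢ Icc (-(1 / 2) : ℝ) (1 / 2)))) :
    crossingNumber φ K = ∑ i ∈ Finset.range N,
      (if ∀ t ∈ Icc (b i) (b (i + 1)), K (circlePt t) ∈ φ '' (univ ×ˢ Ioo (-1 : ℝ) 1)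
        then (0 : ℤ) else
        outerInd φ (K (circlePt (b i))) - outerInd φ (K (circlePt (b (i + 1))))) := by
  classical
  -- a logarithm of the phase loop on `[0, 1]`
  have hf := continuous_phaseLoop hc hφc hφ1 hφp hφi hK hKc
  obtain ⟨l, hl, hle⟩ := Literature.Topology.PlaneTopology.hasLogOn_Icc (a := 0) (b := 1)
    hf.continuousOn fun t _ => Complex.exp_ne_zero _
  have h01 : phaseLoop φ K 0 = phaseLoop φ K 1 := by
    unfold phaseLoop; rw [← circlePt_add_one 0, zero_add]
  have hwind := Literature.Topology.PlaneTopology.wind_spec hl hle h01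
  -- node values of the clamped height
  obtain ⟨E, hE⟩ : ∃ E : ℕ → ℝ, ∀ i : ℕ, E i = clampStep (height φ (K (circlePt (b i)))) :=
    ⟨_, fun i => rfl⟩
  have hIcc : ∀ i < N, Icc (b i) (b (i + 1)) ⊆ Icc (0 : ℝ) 1 := fun i hi =>
    Icc_subset_Icc (breakpoints_mem_Icc hb0 hbN hmono hi.le).1
      (breakpoints_mem_Icc hb0 hbN hmono (Nat.succ_le_of_lt hi)).2
  -- increments of the logarithm along the pieces
  have hinc : ∀ i ∈ Finset.range N, l (b (i + 1)) - l (b i) =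
      (if ∀ t ∈ Icc (b i) (b (i + 1)), K (circlePt t) ∈ φ '' (univ ×ˢ Ioo (-1 : ℝ) 1)
        then (((2 * π * (E (i + 1) - E i) : ℝ) : ℂ) * Complex.I) else 0) := by
    intro i hi
    rw [Finset.mem_range] at hi
    split_ifs with hA
    · rw [log_sub_log_of_annulus hc hφc hφ1 hφp hφi hK (hmono i hi) hA ((hl.mono (hIcc i hi)))
        (fun t ht => hle t (hIcc i hi ht)), hE, hE]
    · exact log_sub_log_of_not_mem_collar (hmono i hi) ((hdes i hi).resolve_left hA)
        (hl.mono (hIcc i hi)) fun t ht => hle t (hIcc i hi ht)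
  -- the clamped heights telescope to zero around the loop
  have htel : ∑ i ∈ Finset.range N, (E (i + 1) - E i) = 0 := by
    rw [Finset.sum_range_sub, hE, hE, hb0, hbN, ← circlePt_add_one 0, zero_add, sub_self]
  -- the logarithm telescopes to `2πi · wind`
  have hlsum : ∑ i ∈ Finset.range N, (l (b (i + 1)) - l (b i)) = l 1 - l 0 := by
    rw [Finset.sum_range_sub (fun i : ℕ => l (b i)) N, hb0, hbN]
  -- outside pieces: `outerInd = χ ∘ height` at both ends
  have hd : ∀ i ∈ Finset.range N,
      (((if ∀ t ∈ Icc (b i) (b (i + 1)), K (circlePt t) ∈ φ '' (univ ×ˢ Ioo (-1 : ℝ) 1)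
        then (0 : ℤ) else
        outerInd φ (K (circlePt (b i))) - outerInd φ (K (circlePt (b (i + 1))))) : ℤ) : ℂ) *
        (2 * π * Complex.I) =
      (if ∀ t ∈ Icc (b i) (b (i + 1)), K (circlePt t) ∈ φ '' (univ ×ˢ Ioo (-1 : ℝ) 1)
        then (((2 * π * (E (i + 1) - E i) : ℝ) : ℂ) * Complex.I) else 0) -
        ((2 * π * (E (i + 1) - E i) : ℝ) : ℂ) * Complex.I := by
    intro i hi
    rw [Finset.mem_range] at hi
    split_ifs with hA
    · simp
    · have hB := (hdes i hi).resolve_left hA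
      have h12 : b i ≤ b (i + 1) := hmono i hi
      have e0 : ((outerInd φ (K (circlePt (b i))) : ℤ) : ℂ) = ((E i : ℝ) : ℂ) := by
        rw [hE, ← outerInd_eq_clampStep (hB _ (left_mem_Icc.2 h12)), Complex.ofReal_intCast]
      have e1 : ((outerInd φ (K (circlePt (b (i + 1)))) : ℤ) : ℂ) = ((E (i + 1) : ℝ) : ℂ) := by
        rw [hE, ← outerInd_eq_clampStep (hB _ (right_mem_Icc.2 h12)), Complex.ofReal_intCast]
      push_cast
      rw [e0, e1]
      ring
  have hzero : ∑ i ∈ Finset.range N, ((2 * π * (E (i + 1) - E i) : ℝ) : ℂ) * Complex.I = 0 := by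
    rw [← Finset.sum_mul, ← Complex.ofReal_sum, ← Finset.mul_sum, htel, mul_zero,
      Complex.ofReal_zero, zero_mul]
  apply Literature.Topology.PlaneTopology.int_eq_of_mul_two_pi_I_eq
  rw [crossingNumber, ← hwind, ← hlsum, Finset.sum_congr rfl hinc, Int.cast_sum, Finset.sum_mul,
    Finset.sum_congr rfl hd, Finset.sum_sub_distrib, hzero, sub_zero]

open Classical in
/-- **The passage formula, inside form**: `crossingNumber φ K = Σ_{inside pieces}
(outerInd qᵢ₊₁ − outerInd qᵢ)` — the sum of the net passages `[hᵢ₊₁ ≥ 1/2] − [hᵢ ≥ 1/2]` of the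
inside pieces across the collar. [cite: Fulton1995, §3] -/
theorem crossingNumber_eq_sum_inside (hc : ‖c‖ = 1) (hφc : Continuous φ)
    (hφ1 : ∀ u r, φ (u + 1, r) = φ (u, r)) (hφp : ∀ p, φ p ∈ page g c)
    (hφi : InjOn φ (Ico (0 : ℝ) 1 ×ˢ Ioo (-1 : ℝ) 1)) (hK : Continuous K)
    (hKc : ∀ θ, K θ ∈ page g c) {N : ℕ} (b : ℕ → ℝ) (hb0 : b 0 = 0) (hbN : b N = 1)
    (hmono : ∀ i < N, b i ≤ b (i + 1))
    (hdes : ∀ i < N,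
      (∀ t ∈ Icc (b i) (b (i + 1)), K (circlePt t) ∈ φ '' (univ ×ˢ Ioo (-1 : ℝ) 1)) ∨
      (∀ t ∈ Icc (b i) (b (i + 1)), K (circlePt t) ∉ φ '' (univ ×ˢ Icc (-(1 / 2) : ℝ) (1 / 2)))) :
    crossingNumber φ K = ∑ i ∈ Finset.range N,
      (if ∀ t ∈ Icc (b i) (b (i + 1)), K (circlePt t) ∈ φ '' (univ ×ˢ Ioo (-1 : ℝ) 1)
        then outerInd φ (K (circlePt (b (i + 1)))) - outerInd φ (K (circlePt (b i))) else (0 : ℤ)) := by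
  classical
  rw [crossingNumber_eq_sum_breakpoints hc hφc hφ1 hφp hφi hK hKc b hb0 hbN hmono hdes]
  -- the full telescoping sum vanishes
  have htel : ∑ i ∈ Finset.range N,
      (outerInd φ (K (circlePt (b (i + 1)))) - outerInd φ (K (circlePt (b i)))) = 0 := by
    rw [Finset.sum_range_sub (fun i : ℕ => outerInd φ (K (circlePt (b i)))) N, hb0, hbN,
      ← circlePt_add_one 0, zero_add, sub_self]
  have key : ∀ i ∈ Finset.range N,
      (if ∀ t ∈ Icc (b i) (b (i + 1)), K (circlePt t) ∈ φ '' (univ ×ˢ Ioo (-1 : ℝ) 1)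
        then (0 : ℤ) else
        outerInd φ (K (circlePt (b i))) - outerInd φ (K (circlePt (b (i + 1))))) =
      (if ∀ t ∈ Icc (b i) (b (i + 1)), K (circlePt t) ∈ φ '' (univ ×ˢ Ioo (-1 : ℝ) 1)
        then outerInd φ (K (circlePt (b (i + 1)))) - outerInd φ (K (circlePt (b i))) else (0 : ℤ)) -
        (outerInd φ (K (circlePt (b (i + 1)))) - outerInd φ (K (circlePt (b i)))) := by
    intro i _
    split_ifs <;> ring
  rw [Finset.sum_congr rfl key, Finset.sum_sub_distrib, htel, sub_zero]

/-- **Along a piece inside the open annulus and off the closed collar the outer indicator is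
constant** (the transverse coordinate is continuous along a lift and avoids `[−1/2, 1/2]`:
intermediate value theorem). [folklore] -/
theorem outerInd_eq_of_piece (hc : ‖c‖ = 1) (hφc : Continuous φ)
    (hφ1 : ∀ u r, φ (u + 1, r) = φ (u, r)) (hφp : ∀ p, φ p ∈ page g c)
    (hφi : InjOn φ (Ico (0 : ℝ) 1 ×ˢ Ioo (-1 : ℝ) 1)) (hK : Continuous K) {t₁ t₂ : ℝ}
    (h12 : t₁ ≤ t₂) (hin : ∀ t ∈ Icc t₁ t₂, K (circlePt t) ∈ φ '' (univ ×ˢ Ioo (-1 : ℝ) 1))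
    (hoff : ∀ t ∈ Icc t₁ t₂, K (circlePt t) ∉ φ '' (univ ×ˢ Icc (-(1 / 2) : ℝ) (1 / 2))) :
    outerInd φ (K (circlePt t₁)) = outerInd φ (K (circlePt t₂)) := by
  classical
  have hL : Continuous fun t : ℝ => K (circlePt t) := hK.comp continuous_circlePt
  obtain ⟨u, r, -, hr, hur⟩ := exists_chart_lift hc hφc hφ1 hφp hφi hL.continuousOn hin
  have hh : ∀ t ∈ Icc t₁ t₂, height φ (K (circlePt t)) = r t := fun t ht => by
    rw [← (hur t ht).2]; exact height_of_lift hφ1 hφi (hur t ht).1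
  have havoid : ∀ t ∈ Icc t₁ t₂, r t < -(1 / 2) ∨ 1 / 2 < r t := fun t ht => by
    by_contra h
    push Not at h
    exact hoff t ht ⟨(u t, r t), ⟨trivial, h.1, h.2⟩, (hur t ht).2⟩
  have h1 := left_mem_Icc.2 h12
  have h2 := right_mem_Icc.2 h12
  -- the two ends are on the same side of the collar band
  have hside : (1 / 2 < r t₁) ↔ (1 / 2 < r t₂) := by
    constructor <;> intro hgt <;> by_contra hle
    · rcases havoid t₂ h2 with hlt | hlt
      · obtain ⟨t, ht, ht0⟩ := isPreconnected_Icc.intermediate_value₂ h2 h1 hr continuousOn_const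
          hlt.le (show (-(1 / 2) : ℝ) ≤ r t₁ by linarith)
        rcases havoid t ht with h' | h' <;> linarith
      · exact hle hlt
    · rcases havoid t₁ h1 with hlt | hlt
      · obtain ⟨t, ht, ht0⟩ := isPreconnected_Icc.intermediate_value₂ h1 h2 hr continuousOn_const
          hlt.le (show (-(1 / 2) : ℝ) ≤ r t₂ by linarith)
        rcases havoid t ht with h' | h' <;> linarith
      · exact hle hlt
  have e : ∀ t ∈ Icc t₁ t₂, outerInd φ (K (circlePt t)) = if 1 / 2 < r t then 1 else 0 := by
    intro t ht
    rw [outerInd, hh t ht]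
    rcases havoid t ht with hlt | hlt
    · rw [if_neg (fun h => by linarith [h.2]), if_neg (by linarith)]
    · rw [if_pos ⟨hin t ht, hlt.le⟩, if_pos hlt]
  rw [e t₁ h1, e t₂ h2]
  simp only [hside]

open Classical in
/-- **A single upward passage has crossing number `1`**: if the unit-period loop of `K` is inside
the open annulus on `[s, t]`, off the closed collar on `[0, s]` and on `[t, 1]`, at height
`< −1/2` at `s` and `> 1/2` at `t`, then `crossingNumber φ K = 1`. [cite: Fulton1995, §3] -/
theorem crossingNumber_single_passage (hc : ‖c‖ = 1) (hφc : Continuous φ)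
    (hφ1 : ∀ u r, φ (u + 1, r) = φ (u, r)) (hφp : ∀ p, φ p ∈ page g c)
    (hφi : InjOn φ (Ico (0 : ℝ) 1 ×ˢ Ioo (-1 : ℝ) 1)) (hK : Continuous K)
    (hKc : ∀ θ, K θ ∈ page g c) {s t : ℝ} (h0s : 0 ≤ s) (hst : s ≤ t) (ht1 : t ≤ 1)
    (hin : ∀ τ ∈ Icc s t, K (circlePt τ) ∈ φ '' (univ ×ˢ Ioo (-1 : ℝ) 1))
    (hout₁ : ∀ τ ∈ Icc 0 s, K (circlePt τ) ∉ φ '' (univ ×ˢ Icc (-(1 / 2) : ℝ) (1 / 2)))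
    (hout₂ : ∀ τ ∈ Icc t 1, K (circlePt τ) ∉ φ '' (univ ×ˢ Icc (-(1 / 2) : ℝ) (1 / 2)))
    (hs : height φ (K (circlePt s)) < -(1 / 2)) (ht : 1 / 2 < height φ (K (circlePt t))) :
    crossingNumber φ K = 1 := by
  classical
  -- breakpoints `0, s, t, 1`
  let b : ℕ → ℝ := fun i => if i = 0 then 0 else if i = 1 then s else if i = 2 then t else 1
  have hb0 : b 0 = 0 := rfl
  have hb1 : b 1 = s := rfl
  have hb2 : b 2 = t := rfl
  have hb3 : b 3 = 1 := rfl
  have hmono : ∀ i < 3, b i ≤ b (i + 1) := by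
    intro i hi
    interval_cases i
    · rw [hb0, hb1]; exact h0s
    · rw [hb1, hb2]; exact hst
    · rw [hb2, hb3]; exact ht1
  have hdes : ∀ i < 3,
      (∀ τ ∈ Icc (b i) (b (i + 1)), K (circlePt τ) ∈ φ '' (univ ×ˢ Ioo (-1 : ℝ) 1)) ∨
      (∀ τ ∈ Icc (b i) (b (i + 1)), K (circlePt τ) ∉ φ '' (univ ×ˢ Icc (-(1 / 2) : ℝ) (1 / 2))) := by
    intro i hi
    interval_cases i
    · exact Or.inr hout₁
    · exact Or.inl hin
    · exact Or.inr hout₂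
  rw [crossingNumber_eq_sum_inside hc hφc hφ1 hφp hφi hK hKc b hb0 hb3 hmono hdes]
  have hA_t : K (circlePt t) ∈ φ '' (univ ×ˢ Ioo (-1 : ℝ) 1) := hin t ⟨hst, le_rfl⟩
  have hOs : outerInd φ (K (circlePt s)) = 0 := by
    rw [outerInd, if_neg]; exact fun h => by linarith [h.2]
  have hOt : outerInd φ (K (circlePt t)) = 1 := by
    rw [outerInd, if_pos ⟨hA_t, ht.le⟩]
  rw [Finset.sum_range_succ, Finset.sum_range_succ, Finset.sum_range_one, hb0, hb1, hb2, hb3,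
    if_pos hin, hOs, hOt]
  -- an outside piece that happens to run inside the annulus has equal indicators at its ends
  have e0 : (if ∀ τ ∈ Icc (0 : ℝ) s, K (circlePt τ) ∈ φ '' (univ ×ˢ Ioo (-1 : ℝ) 1)
      then (0 : ℤ) - outerInd φ (K (circlePt 0)) else 0) = 0 := by
    split_ifs with h
    · rw [outerInd_eq_of_piece hc hφc hφ1 hφp hφi hK h0s h hout₁, hOs, sub_self]
    · rfl
  have e2 : (if ∀ τ ∈ Icc t (1 : ℝ), K (circlePt τ) ∈ φ '' (univ ×ˢ Ioo (-1 : ℝ) 1)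
      then outerInd φ (K (circlePt 1)) - (1 : ℤ) else 0) = 0 := by
    split_ifs with h
    · rw [← outerInd_eq_of_piece hc hφc hφ1 hφp hφi hK ht1 h hout₂, hOt, sub_self]
    · rfl
  rw [e0, e2]
  norm_num

/-! ## §3 The registered form -/

/-- **Sub-goal `helper_crossingNumber_passage`** (Z6-4, a tool for the evaluation step of the
missing lemma of node N1a of NF4): a loop of the page crossing the annulus of the chart ONCE,
UPWARDS — inside the open annulus `φ(ℝ × (−1, 1))` on `[s, t]`, from height `< −1/2` to height
`> 1/2`, and off the closed collar `φ(ℝ × [−1/2, 1/2])` on `[0, s]` and `[t, 1]` — has crossing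
number `1`. [cite: Fulton1995, §3] -/
theorem helper_crossingNumber_passage : ∀ (g : ℕ) (c : ℂ) (_hc : ‖c‖ = 1) (φ : ℝ × ℝ → Literature.Topology.FourManifolds.LefschetzBase.Base g) (_hφc : Continuous φ) (_hφ1 : ∀ u r, φ (u + 1, r) = φ (u, r)) (_hφp : ∀ p, φ p ∈ Literature.Topology.FourManifolds.LefschetzBase.page g c) (_hφi : Set.InjOn φ (Set.Ico (0 : ℝ) 1 ×ˢ Set.Ioo (-1 : ℝ) 1)) (K : Metric.sphere (0 : EuclideanSpace ℝ (Fin 2)) 1 → Literature.Topology.FourManifolds.LefschetzBase.Base g) (_hK : Continuous K) (_hKc : ∀ θ, K θ ∈ Literature.Topology.FourManifolds.LefschetzBase.page g c) (s t : ℝ), 0 ≤ s → s ≤ t → t ≤ 1 → (∀ τ ∈ Set.Icc s t, K (Literature.Topology.FourManifolds.circlePt τ) ∈ φ '' (Set.univ ×ˢ Set.Ioo (-1 : ℝ) 1)) → (∀ τ ∈ Set.Icc 0 s, K (Literature.Topology.FourManifolds.circlePt τ) ∉ φ '' (Set.univ ×ˢ Set.Icc (-(1 / 2) : ℝ) (1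 / 2))) → (∀ τ ∈ Set.Icc t 1, K (Literature.Topology.FourManifolds.circlePt τ) ∉ φ '' (Set.univ ×ˢ Set.Icc (-(1 / 2) : ℝ) (1 / 2))) → Summit.SmoothPoincare4.SmoothPoincare4.Theorems.AcyclicBisectionExists.ModpBraidOrbits.height φ (K (Literature.Topology.FourManifolds.circlePt s)) < -(1 / 2) → 1 / 2 < Summit.SmoothPoincare4.SmoothPoincare4.Theorems.AcyclicBisectionExists.ModpBraidOrbits.height φ (K (Literature.Topology.FourManifolds.circlePt t)) → Summit.SmoothPoincare4.SmoothPoincare4.Theorems.AcyclicBisectionExists.ModpBraidOrbits.crossingNumber φ K = 1 :=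
  fun _ _ hc _ hφc hφ1 hφp hφi _ hK hKc _ _ h0s hst ht1 hin hout₁ hout₂ hs ht =>
    crossingNumber_single_passage hc hφc hφ1 hφp hφi hK hKc h0s hst ht1 hin hout₁ hout₂ hs ht

end Summit.SmoothPoincare4.SmoothPoincare4.Theorems.AcyclicBisectionExists.ModpBraidOrbits

end
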